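import Summits.Ventures.HodgeRepro2.A2Avoidance
import Summits.Ventures.HodgeRepro2.A2RationalIso

/-!
# (A4.2.7) — the classes θ_i: a rational class with every eigen-coordinate non-zero

Blind cell pub-hodge-repro2, seat p6 (sub-claim A2 annex, Tier 4). Imports my rows 1 (`A2Avoidance`: Lemma A4.2.6,
`exists_notMem_of_forall_ne_top`) and 12 (`A2RationalIso`: `eq_zero_of_forall_one_tmul`, «a K-linear functional on
K ⊗ V vanishing on 1 ⊗ V is 0»).

THE PROSE (route/T4-A2-p6.md, (A4.2.7)): «For ν = 1, 2, 3 let λ_{i,ν}: D_i ⊗ ℂ → ℂ be the coordinate functional with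
respect to the decomposition D_i ⊗ ℂ = ⊕_ν ℓ_{i,τ_ν} ∧ ℓ_{i,τ̄_ν} … its restriction to D_i is non-zero … By Lemma
A4.2.6 there is θ_i ∈ D_i outside the three proper subspaces ker(λ_{i,ν}|_{D_i}), i.e. θ_i = Σ_ν c_{i,ν} E_{i,ν} with
c_{i,ν} := λ_{i,ν}(θ_i) ∈ ℂ^×.»

WHAT IS PROVED HERE (F ⊂ K any fields with F infinite; D an F-vector space; ι a finite index type):
* `restrictKer` — the F-subspace `{d ∈ D | λ(1 ⊗ d) = 0}` of `D` cut out by a K-functional `λ` on `K ⊗ D`;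
  `restrictKer_ne_top` — it is proper when `λ ≠ 0` (row 12).
* **`exists_forall_ne_zero`** — for finitely many non-zero K-functionals `λ_ν` on `K ⊗_F D` there is `θ ∈ D` with
  `λ_ν(1 ⊗ θ) ≠ 0` for every `ν` (row 1's avoidance on the proper subspaces `restrictKer (λ_ν)`).
* **`exists_theta_of_basis`** — the display of (A4.2.7): for a K-basis `(E_ν)` of `K ⊗_F D` there is `θ ∈ D` with
  `1 ⊗ θ = Σ_ν c_ν E_ν`, all `c_ν = E^*_ν(1 ⊗ θ)` non-zero.
What stays prose: that `D_i` is the rational subspace of Lemma A4.2.2 and that the `E_{i,ν} = ℓ_{i,τ_ν} ∧ ℓ_{i,τ̄_ν}`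
form a basis of `D_i ⊗ ℂ` (Lemma A4.2.2's dimension count, rows 4 / 11).
§8(d) declaration: uses an L-value-free non-vanishing device: NO.
-/

namespace Summit.Ventures.HodgeRepro2.A2ThetaExists

open Summit.Ventures.HodgeRepro2.A2Avoidance
open Summit.Ventures.HodgeRepro2.A2RationalIso
open TensorProduct

variable {F K : Type*} [Field F] [Field K] [Algebra F K] {D : Type*} [AddCommGroup D] [Module F D]

/-- The F-subspace of `D` on which the K-functional `λ` on `K ⊗_F D` vanishes through `d ↦ 1 ⊗ d`:
`ker(λ|_{D})` in the prose. -/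
def restrictKer (lam : K ⊗[F] D →ₗ[K] K) : Submodule F D :=
  LinearMap.ker ((lam.restrictScalars F) ∘ₗ (TensorProduct.mk F K D 1))

/-- `d ∈ restrictKer λ ↔ λ(1 ⊗ d) = 0`. -/
@[simp] lemma mem_restrictKer (lam : K ⊗[F] D →ₗ[K] K) (d : D) :
    d ∈ restrictKer lam ↔ lam (1 ⊗ₜ[F] d) = 0 := by
  simp [restrictKer]

/-- «its restriction to `D_i` is non-zero»: for `λ ≠ 0` the subspace `restrictKer λ` is proper (row 12:
a K-functional vanishing on `1 ⊗ D` is zero). -/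
lemma restrictKer_ne_top (lam : K ⊗[F] D →ₗ[K] K) (hlam : lam ≠ 0) : restrictKer lam ≠ ⊤ := by
  intro htop
  apply hlam
  apply eq_zero_of_forall_one_tmul
  intro d
  have hd : d ∈ restrictKer lam := by rw [htop]; exact Submodule.mem_top
  exact (mem_restrictKer lam d).mp hd

/-- **(A4.2.7), avoidance step**: finitely many non-zero K-functionals on `K ⊗_F D` are simultaneously non-zero at
`1 ⊗ θ` for some `θ ∈ D` (Lemma A4.2.6 = row 1 on the proper subspaces `restrictKer (λ_ν)`). -/
theorem exists_forall_ne_zero [Infinite F] {ι : Type*} [Fintype ι] (lam : ι → (K ⊗[F] D →ₗ[K] K))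
    (hlam : ∀ ν, lam ν ≠ 0) : ∃ θ : D, ∀ ν, lam ν (1 ⊗ₜ[F] θ) ≠ 0 := by
  classical
  obtain ⟨θ, hθ⟩ := exists_notMem_of_forall_ne_top (Finset.univ.image fun ν => restrictKer (lam ν)) (by
    intro U hU
    obtain ⟨ν, -, rfl⟩ := Finset.mem_image.mp hU
    exact restrictKer_ne_top (lam ν) (hlam ν))
  refine ⟨θ, fun ν h => ?_⟩
  have : θ ∉ restrictKer (lam ν) := hθ _ (Finset.mem_image.mpr ⟨ν, Finset.mem_univ ν, rfl⟩)
  exact this ((mem_restrictKer (lam ν) θ).mpr h)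

/-- **(A4.2.7), the display**: for a K-basis `(E_ν)_ν` of `K ⊗_F D` (the lines `ℓ_{i,τ_ν} ∧ ℓ_{i,τ̄_ν}`) there is
`θ ∈ D` with `1 ⊗ θ = Σ_ν c_ν E_ν` and every coordinate `c_ν = E^*_ν(1 ⊗ θ)` non-zero. -/
theorem exists_theta_of_basis [Infinite F] {ι : Type*} [Fintype ι] (b : Module.Basis ι K (K ⊗[F] D)) :
    ∃ θ : D, (∀ ν, b.coord ν (1 ⊗ₜ[F] θ) ≠ 0) ∧
      (1 ⊗ₜ[F] θ : K ⊗[F] D) = ∑ ν, b.coord ν (1 ⊗ₜ[F] θ) • b ν := by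
  obtain ⟨θ, hθ⟩ := exists_forall_ne_zero (fun ν => b.coord ν) (fun ν => by
    intro h
    have := LinearMap.congr_fun h (b ν)
    simp at this)
  exact ⟨θ, hθ, (b.sum_repr (1 ⊗ₜ[F] θ)).symm⟩

end Summit.Ventures.HodgeRepro2.A2ThetaExists
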